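import Summits.KontsevichZagierPeriods.KontsevichZagierPeriods.Theorems.SoloInformedToricNondegenerate
import Summits.KontsevichZagierPeriods.KontsevichZagierPeriods.Theorems.SoloInformedAlgToricChart
import HarnessLib

/-!
# The face lemma and THEOREM ND for denominators with real algebraic coefficients

Solo programme `solo-KontsevichZagierPeriods-informed`, session s107: the re-base of the
DEN-calculus of the cube crux on a coefficient field `K` of real algebraic numbers
(`SoloInformedAlgGerm`, `SoloInformedAlgToricChart`), step 3 — initial forms, cube-nondegeneracy,
the face lemma and THEOREM ND for `Q ∈ K[x₁, …, xₙ]`.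

* `soloInformedInitFormK w Q` — the initial form `in_w(Q)` (terms of least `w`-degree) of a
  polynomial with coefficients in any commutative semiring `k`;
* `SoloInformedCubeNondegenerateK Q` — cube-nondegeneracy (`k` an algebra of scalars of `ℝ`):
  no initial form `in_w(Q)`, `w ∈ ℕⁿ`, vanishes on the half-open cube `(0,1]ⁿ`;
* `soloInformed_chartQuotK_mul_eq_initFormK` — the face identity
  `Q_A(x) · y^{a₀} = in_w(Q)(y)` (`w` the face weight of `x ∈ [0,1]ⁿ`, `y = μ_A(x')`);
* `soloInformed_chartQuotK_ne_zero_of_nondegenerate` — THE FACE LEMMA: for cube-nondegenerate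
  `Q` the chart quotient `Q_A` has no zero on the closed cube, on every chart with least
  pulled-back exponent `m = Aᵀ a₀`;
* `soloInformed_presentable_of_nondegenerateK` — **THEOREM ND over `K`**: for a field `K` with
  `hK : ∀ c, IsAlgebraic ℚ (algebraMap K ℝ c)`, `Q ∈ K[x]` cube-nondegenerate and `r` an
  `IntegralRep` on `[0,1]ⁿ` with integrand `x^p/Q(x)` on the open cube, `of r` is presentable
  (toric charts with chain exponents, the one-chart lemma `soloInformed_presentable_toricChartK_of_ne`,
  gluing by domain additivity up to null sets) — and the same in the output format of the cube
  crux (`soloInformed_cubeResolution_nondegenerateK`).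

The weights, face weights and filled points (`soloInformedWDeg`, `soloInformedFaceWeight`,
`soloInformedFillOne`) are those of `SoloInformedToricFace`; the proofs are those of the case
`K = ℚ` (`SoloInformedToricFace`, `SoloInformedToricNondegenerate`), coefficient casts replaced by
`algebraMap k ℝ`.

References: A. G. Kouchnirenko, Invent. Math. 32 (1976) §1; A. N. Varchenko, Funct. Anal. Appl. 10
(1976); W. Fulton, *Introduction to Toric Varieties* (1993), §2.6; J. Ayoub, EMS Newsl. 91 (2014),
§2.2; M. Kontsevich, D. Zagier, *Periods* (2001), §1.1–1.2.
-/

noncomputable section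

open scoped BigOperators
open MeasureTheory Set
open Literature.NumberTheory.Transcendental Literature.NumberTheory.Transcendental.KZ
open Literature.ModelTheory.ExponentialFields (IsSemialgebraic)
open Literature.AlgebraicGeometry.Resolution

namespace Summit.KontsevichZagierPeriods.KontsevichZagierPeriods.Theorems

variable {n : ℕ}

/-! ### Initial forms over a general coefficient semiring -/

section CoeffRing

variable {k : Type*} [CommSemiring k]

/-- `a` is **`w`-initial** for `Q ∈ k[x]` if its `w`-degree is least among the support of `Q`.
[Kouchnirenko 1976, §1] -/
def SoloInformedIsInitK (w : Fin n → ℕ) (Q : MvPolynomial (Fin n) k) (a : Fin n →₀ ℕ) : Prop :=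
  ∀ b ∈ Q.support, soloInformedWDeg w a ≤ soloInformedWDeg w b

open Classical in
/-- The **initial form** `in_w(Q)` of `Q ∈ k[x]`: the terms of `Q` of least `w`-degree.
[Kouchnirenko 1976, §1] -/
def soloInformedInitFormK (w : Fin n → ℕ) (Q : MvPolynomial (Fin n) k) : MvPolynomial (Fin n) k :=
  ∑ a ∈ Q.support.filter (SoloInformedIsInitK w Q),
    MvPolynomial.monomial a (MvPolynomial.coeff a Q)

open Classical in
/-- Evaluation of the initial form. [this work] -/
theorem soloInformed_aeval_initFormK {R : Type*} [CommSemiring R] [Algebra k R] (w : Fin n → ℕ)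
    (Q : MvPolynomial (Fin n) k) (y : Fin n → R) :
    MvPolynomial.aeval y (soloInformedInitFormK w Q) =
      ∑ a ∈ Q.support.filter (SoloInformedIsInitK w Q),
        algebraMap k R (MvPolynomial.coeff a Q) * ∏ i, y i ^ a i := by
  unfold soloInformedInitFormK
  rw [map_sum]
  exact Finset.sum_congr rfl fun a _ => by
    rw [MvPolynomial.aeval_monomial, Finsupp.prod_fintype _ _ fun i => pow_zero _]

/-- On a chart with least pulled-back exponent `m = Aᵀ a₀`, an exponent `a ∈ supp Q` is initial for
the face weight of `x` iff `(Aᵀ a)_j = m_j` at every zero coordinate `j` of `x`. [this work] -/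
theorem soloInformed_isInitK_iff (A : Matrix (Fin n) (Fin n) ℕ) (Q : MvPolynomial (Fin n) k)
    {m : Fin n → ℕ} {a₀ : Fin n →₀ ℕ} (ha₀ : a₀ ∈ Q.support) (hm₀ : ∀ j, m j = ∑ i, A i j * a₀ i)
    (hmin : ∀ a ∈ Q.support, ∀ j, m j ≤ ∑ i, A i j * a i) (x : Fin n → ℝ) {a : Fin n →₀ ℕ}
    (ha : a ∈ Q.support) :
    SoloInformedIsInitK (soloInformedFaceWeight A x) Q a ↔
      ∀ j, x j = 0 → (∑ i, A i j * a i) = m j := by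
  have hdeg : ∀ b : Fin n →₀ ℕ, soloInformedWDeg (soloInformedFaceWeight A x) b =
      ∑ j, if x j = 0 then ∑ i, A i j * b i else 0 := soloInformed_wdeg_faceWeight A x
  have hdeg₀ : soloInformedWDeg (soloInformedFaceWeight A x) a₀ =
      ∑ j, if x j = 0 then m j else 0 := by
    rw [hdeg]; exact Finset.sum_congr rfl fun j _ => by rw [hm₀ j]
  have hle : ∀ b ∈ Q.support, ∀ j ∈ (Finset.univ : Finset (Fin n)),
      (if x j = 0 then m j else 0) ≤ (if x j = 0 then ∑ i, A i j * b i else 0) := by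
    intro b hb j _
    split_ifs with h
    · exact hmin b hb j
    · exact le_rfl
  constructor
  · intro h j hj
    have h1 : soloInformedWDeg (soloInformedFaceWeight A x) a ≤
        soloInformedWDeg (soloInformedFaceWeight A x) a₀ := h a₀ ha₀
    rw [hdeg, hdeg₀] at h1
    have h2 : (∑ j, if x j = 0 then m j else 0) ≤
        ∑ j, if x j = 0 then ∑ i, A i j * a i else 0 := Finset.sum_le_sum (hle a ha)
    have heq := (Finset.sum_eq_sum_iff_of_le (hle a ha)).1 (le_antisymm h2 h1)
    have := heq j (Finset.mem_univ j)
    simp only [hj, if_true] at this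
    exact this.symm
  · intro h b hb
    rw [hdeg, hdeg]
    refine Finset.sum_le_sum fun j _ => ?_
    split_ifs with hj
    · rw [h j hj]; exact hmin b hb j
    · exact le_rfl

/-- For `w = 0` every exponent is initial, so `in_0(Q) = Q`. [this work] -/
theorem soloInformed_initFormK_zero (Q : MvPolynomial (Fin n) k) :
    soloInformedInitFormK 0 Q = Q := by
  classical
  unfold soloInformedInitFormK
  rw [Finset.filter_true_of_mem fun a _ b _ => by simp [soloInformedWDeg]]
  exact (MvPolynomial.as_sum Q).symm

end CoeffRing

/-! ### Cube-nondegeneracy, the face identity and the face lemma -/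

section RealAlg

variable {k : Type*} [CommSemiring k] [Algebra k ℝ]

/-- **Cube-nondegeneracy** of `Q ∈ k[x₁, …, xₙ]` (`k` a ring of real scalars): no initial form of
`Q` vanishes anywhere on the half-open cube `(0,1]ⁿ`. [this work; cf. Kouchnirenko 1976,
Varchenko 1976] -/
def SoloInformedCubeNondegenerateK (Q : MvPolynomial (Fin n) k) : Prop :=
  ∀ (w : Fin n → ℕ) (y : Fin n → ℝ), (∀ i, 0 < y i ∧ y i ≤ 1) →
    (MvPolynomial.aeval y (soloInformedInitFormK w Q) : ℝ) ≠ 0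

/-- **The face identity** over `k`: on a chart `A` with least pulled-back exponent `m = Aᵀ a₀`
over `supp Q`, for `x ∈ [0,1]ⁿ` with filled point `x'` and `y = μ_A(x')`,
`Q_A(x) · ∏ᵢ yᵢ^{(a₀)ᵢ} = in_w(Q)(y)` for the face weight `w` of `x`. [this work] -/
theorem soloInformed_chartQuotK_mul_eq_initFormK (A : Matrix (Fin n) (Fin n) ℕ)
    (Q : MvPolynomial (Fin n) k) {m : Fin n → ℕ} {a₀ : Fin n →₀ ℕ} (ha₀ : a₀ ∈ Q.support)
    (hm₀ : ∀ j, m j = ∑ i, A i j * a₀ i) (hmin : ∀ a ∈ Q.support, ∀ j, m j ≤ ∑ i, A i j * a i)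
    (x : Fin n → ℝ) :
    (MvPolynomial.aeval x (soloInformedChartQuotK A Q m) : ℝ) *
        ∏ i, (∏ j, soloInformedFillOne x j ^ A i j) ^ a₀ i =
      MvPolynomial.aeval (fun i => ∏ j, soloInformedFillOne x j ^ A i j)
        (soloInformedInitFormK (soloInformedFaceWeight A x) Q) := by
  classical
  set x' := soloInformedFillOne x with hx'
  rw [soloInformed_aeval_chartQuotK, soloInformed_aeval_initFormK, Finset.sum_filter,
    Finset.sum_mul]
  refine Finset.sum_congr rfl fun a ha => ?_
  have hya : (∏ i, (∏ j, x' j ^ A i j) ^ a i) = ∏ j, x' j ^ (∑ i, A i j * a i) :=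
    prod_pow_monomialMap A (fun i => a i) (fun i => rfl)
  have hy₀ : (∏ i, (∏ j, x' j ^ A i j) ^ a₀ i) = ∏ j, x' j ^ m j := by
    rw [prod_pow_monomialMap A (fun i => a₀ i) (fun i => rfl)]
    exact Finset.prod_congr rfl fun j _ => by rw [hm₀ j]
  by_cases hP : SoloInformedIsInitK (soloInformedFaceWeight A x) Q a
  · rw [if_pos hP]
    have hj : ∀ j, x j = 0 → (∑ i, A i j * a i) = m j :=
      (soloInformed_isInitK_iff A Q ha₀ hm₀ hmin x ha).1 hP
    have h1 : (∏ j, x j ^ ((∑ i, A i j * a i) - m j)) =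
        ∏ j, x' j ^ ((∑ i, A i j * a i) - m j) := by
      refine Finset.prod_congr rfl fun j _ => ?_
      by_cases h : x j = 0
      · rw [hj j h, Nat.sub_self, pow_zero, pow_zero]
      · simp only [hx', soloInformedFillOne, h, if_false]
    have h2 : (∏ j, x' j ^ ((∑ i, A i j * a i) - m j)) * ∏ j, x' j ^ m j =
        ∏ j, x' j ^ (∑ i, A i j * a i) := by
      rw [mul_comm]
      exact (prod_pow_eq_mul_of_le x' (p := m) (q := fun j => ∑ i, A i j * a i)
        fun j => hmin a ha j).symm
    rw [hy₀, hya, mul_assoc, h1, h2]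
  · rw [if_neg hP]
    have hj : ∃ j, x j = 0 ∧ (∑ i, A i j * a i) ≠ m j := by
      by_contra hcon
      push Not at hcon
      exact hP ((soloInformed_isInitK_iff A Q ha₀ hm₀ hmin x ha).2 hcon)
    obtain ⟨j, hj0, hjne⟩ := hj
    have hpos : (∑ i, A i j * a i) - m j ≠ 0 := by
      have := hmin a ha j
      omega
    have hzero : (∏ j, x j ^ ((∑ i, A i j * a i) - m j)) = 0 :=
      Finset.prod_eq_zero (Finset.mem_univ j) (by rw [hj0, zero_pow hpos])
    rw [hzero, mul_zero, zero_mul]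

/-- **THE FACE LEMMA** over `k`.  If `Q` is cube-nondegenerate then on every toric chart `A` with
least pulled-back exponent `m = Aᵀ a₀` over `supp Q` the chart quotient `Q_A` has no zero on the
closed cube `[0,1]ⁿ`. [this work; the toric case of Varchenko 1976, read on the real cube] -/
theorem soloInformed_chartQuotK_ne_zero_of_nondegenerate (A : Matrix (Fin n) (Fin n) ℕ)
    (Q : MvPolynomial (Fin n) k) (hND : SoloInformedCubeNondegenerateK Q)
    {m : Fin n → ℕ} {a₀ : Fin n →₀ ℕ} (ha₀ : a₀ ∈ Q.support) (hm₀ : ∀ j, m j = ∑ i, A i j * a₀ i)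
    (hmin : ∀ a ∈ Q.support, ∀ j, m j ≤ ∑ i, A i j * a i) {x : Fin n → ℝ}
    (hx : ∀ j, 0 ≤ x j ∧ x j ≤ 1) :
    (MvPolynomial.aeval x (soloInformedChartQuotK A Q m) : ℝ) ≠ 0 := by
  intro h0
  have h := soloInformed_chartQuotK_mul_eq_initFormK A Q ha₀ hm₀ hmin x
  rw [h0, zero_mul] at h
  exact hND (soloInformedFaceWeight A x) _ (soloInformed_monomial_fillOne_mem A hx) h.symm

/-- A cube-nondegenerate polynomial is non-zero (`in_0(0) = 0` vanishes at `(1, …, 1)`).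
[this work] -/
theorem soloInformed_ne_zero_of_cubeNondegenerateK {Q : MvPolynomial (Fin n) k}
    (hND : SoloInformedCubeNondegenerateK Q) : Q ≠ 0 := by
  rintro rfl
  exact hND 0 (fun _ => 1) (fun _ => ⟨one_pos, le_rfl⟩) (by simp [soloInformedInitFormK])

/-- A cube-nondegenerate polynomial has no zero on the half-open cube `(0,1]ⁿ` (`w = 0`).
[this work] -/
theorem soloInformed_aevalK_ne_zero_of_nondegenerate {Q : MvPolynomial (Fin n) k}
    (hND : SoloInformedCubeNondegenerateK Q) {x : Fin n → ℝ} (hx : ∀ i, 0 < x i ∧ x i ≤ 1) :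
    (MvPolynomial.aeval x Q : ℝ) ≠ 0 := by
  have h := hND 0 x hx
  rwa [soloInformed_initFormK_zero] at h

end RealAlg

/-! ### THEOREM ND over a field of real algebraic numbers -/

variable {K : Type*} [Field K] [Algebra K ℝ]

/-- **THEOREM ND over `K`, sandwich version — the cube-nondegenerate toric rung of the cube
crux, coefficients in a field `K` of real algebraic numbers.**  Let `r` be an `IntegralRep` whose
domain `σ` satisfies `(0,1)ⁿ ⊆ σ ⊆ [0,1]ⁿ` and whose integrand agrees on the open cube with
`x^p / Q(x)`, where `p ∈ ℕⁿ` and `Q ∈ K[x₁, …, xₙ]` is cube-nondegenerate.  Then `of r` is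
presentable: `k • of r − ∑ⱼ cⱼ • of ρⱼ ∈ KZ.relations` for some `k ≠ 0` and finitely many cube
integrals `ρⱼ` of real parts of germs holomorphic near the closed cube, real on real points and
algebraic over `ℚ(z)`. [this work; Kouchnirenko 1976 / Varchenko 1976; Ayoub 2014 §2.2;
Fulton 1993 §2.6] -/
theorem soloInformed_presentable_of_nondegenerateK_of_subset
    (hK : ∀ c : K, IsAlgebraic ℚ (algebraMap K ℝ c)) (p : Fin n → ℕ)
    (Q : MvPolynomial (Fin n) K) (hND : SoloInformedCubeNondegenerateK Q) (r : IntegralRep n)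
    (hr₁ : soloInformedOpenCube n ⊆ r.domain) (hr₂ : r.domain ⊆ soloInformedCube n)
    (hri : EqOn r.integrand (fun x => (∏ j, x j ^ p j) / (MvPolynomial.aeval x Q : ℝ))
      (soloInformedOpenCube n)) :
    of r ∈ soloInformedPresentable := by
  classical
  have hQ0 : Q ≠ 0 := soloInformed_ne_zero_of_cubeNondegenerateK hND
  have hO := soloInformedOpenCube_eq_pi n
  obtain ⟨M, A, hdet, hdisj, hcov, hcmp⟩ :=
    MonomialCubeChart.exists_cube_charts_pairwise_comparable n
      (Q.support.image fun a : Fin n →₀ ℕ => (a : Fin n → ℕ))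
  rw [← hO] at hdisj hcov
  have hne : Q.support.Nonempty :=
    Finset.nonempty_iff_ne_empty.2 fun h => hQ0 (MvPolynomial.support_eq_empty.1 h)
  have hmaps : ∀ c, MapsTo (fun (v : Fin n → ℝ) (i : Fin n) => ∏ j, v j ^ A c i j)
      (soloInformedOpenCube n) (soloInformedOpenCube n) := fun c => by
    rw [hO]; exact monomialMap_mapsTo_pi_Ioo (hdet c)
  have himg : ∀ c, IsSemialgebraic ℚ
      ((fun (v : Fin n → ℝ) (i : Fin n) => ∏ j, v j ^ A c i j) '' soloInformedOpenCube n) :=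
    fun c => IsSemialgebraicMapOn.isSemialgebraic_image_holds
      (isSemialgebraicMapOn_monomialMap (A c) (isSemialgebraic_soloInformedOpenCube n))
      Subset.rfl (isSemialgebraic_soloInformedOpenCube n)
  have hsub : ∀ c, (fun (v : Fin n → ℝ) (i : Fin n) => ∏ j, v j ^ A c i j) ''
      soloInformedOpenCube n ⊆ r.domain := fun c => (hmaps c).image_subset.trans hr₁
  -- the chart pieces
  set R : Fin M → IntegralRep n := fun c =>
    r.restrict ((fun (v : Fin n → ℝ) (i : Fin n) => ∏ j, v j ^ A c i j) '' soloInformedOpenCube n)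
      (himg c) (hsub c) with hR
  have hRdom : ∀ c, (R c).domain =
      (fun (v : Fin n → ℝ) (i : Fin n) => ∏ j, v j ^ A c i j) '' soloInformedOpenCube n :=
    fun c => rfl
  have hpiece : ∀ c, of (R c) ∈ soloInformedPresentable := by
    intro c
    obtain ⟨a₀, ha₀, hmin⟩ := soloInformed_exists_least_of_pairwise_comparable Q.support hne
      (fun (a : Fin n →₀ ℕ) (j : Fin n) => ∑ i, A c i j * a i) fun a ha b hb =>
        hcmp c _ (Finset.mem_image_of_mem _ ha) _ (Finset.mem_image_of_mem _ hb)
    exact soloInformed_presentable_toricChartK_of_ne hK (A c) (hdet c) p Q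
      (fun j => ∑ i, A c i j * a₀ i) hmin
      (fun x hx => soloInformed_chartQuotK_ne_zero_of_nondegenerate (A c) Q hND ha₀
        (fun j => rfl) hmin hx)
      (R c) (hRdom c) fun v hv => hri (hmaps c hv)
  -- gluing by domain additivity up to null sets
  have hU : (⋃ c ∈ (Finset.univ : Finset (Fin M)), (R c).domain) =
      ⋃ c, (fun (v : Fin n → ℝ) (i : Fin n) => ∏ j, v j ^ A c i j) '' soloInformedOpenCube n := by
    simp only [Finset.mem_univ, Set.iUnion_true, hRdom]
  have hglue : of r - ∑ c, of (R c) ∈ relations := by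
    refine of_sub_sum_of_mem_relations Finset.univ r R (fun c _ => ?_) (fun c _ _ _ => rfl) ?_ ?_
    · rw [hRdom, Set.sdiff_eq_empty.2 (hsub c)]; exact measure_empty
    · rw [hU]
      refine measure_mono_null (fun x hx => ?_)
        (measure_union_null (soloInformed_volume_cube_diff_openCube n) hcov)
      by_cases hxo : x ∈ soloInformedOpenCube n
      · exact Or.inr ⟨hxo, hx.2⟩
      · exact Or.inl ⟨hr₂ hx.1, hxo⟩
    · intro c _ c' _ hcc'
      rw [hRdom, hRdom, (hdisj hcc').inter_eq]; exact measure_empty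
  exact soloInformed_presentable_of_sub_mem hglue
    (soloInformed_presentable_sum _ _ fun c _ => hpiece c)

/-- **THEOREM ND over `K`** for representations on the closed cube `[0,1]ⁿ` with integrand
`x^p/Q(x)` on the open cube, `Q ∈ K[x]` cube-nondegenerate. [this work] -/
theorem soloInformed_presentable_of_nondegenerateK
    (hK : ∀ c : K, IsAlgebraic ℚ (algebraMap K ℝ c)) (p : Fin n → ℕ)
    (Q : MvPolynomial (Fin n) K) (hND : SoloInformedCubeNondegenerateK Q) (r : IntegralRep n)
    (hr : r.domain = soloInformedCube n)
    (hri : EqOn r.integrand (fun x => (∏ j, x j ^ p j) / (MvPolynomial.aeval x Q : ℝ))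
      (soloInformedOpenCube n)) :
    of r ∈ soloInformedPresentable :=
  soloInformed_presentable_of_nondegenerateK_of_subset hK p Q hND r
    (hr ▸ soloInformedOpenCube_subset_cube n) hr.le hri

/-- **THEOREM ND over `K` in the output format of the cube crux**
`SoloInformedAyoubCubeResolutionCube`: integrands `x^p/Q` on `[0,1]ⁿ` with cube-nondegenerate
`Q ∈ K[x]` admit an Ayoub cube resolution inside the KZ calculus. [this work] -/
theorem soloInformed_cubeResolution_nondegenerateK
    (hK : ∀ c : K, IsAlgebraic ℚ (algebraMap K ℝ c)) (p : Fin n → ℕ)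
    (Q : MvPolynomial (Fin n) K) (hND : SoloInformedCubeNondegenerateK Q) (r : IntegralRep n)
    (hr : r.domain = soloInformedCube n)
    (hri : EqOn r.integrand (fun x => (∏ j, x j ^ p j) / (MvPolynomial.aeval x Q : ℝ))
      (soloInformedOpenCube n)) :
    ∃ (k : ℕ) (_ : k ≠ 0) (m : ℕ) (d : Fin m → ℕ) (G : ∀ j, SoloInformedCubeGerm (d j))
      (c : Fin m → ℤ) (ρ : ∀ j, IntegralRep (d j)),
      (∀ j, (ρ j).domain = soloInformedCube (d j)) ∧
      (∀ j, EqOn (ρ j).integrand (fun x => ((G j).g (soloInformedToC (d j) x)).re)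
        (soloInformedCube (d j))) ∧
      k • of r - ∑ j, c j • of (ρ j) ∈ relations :=
  soloInformed_exists_fin_of_presentable
    (soloInformed_presentable_of_nondegenerateK hK p Q hND r hr hri)

end Summit.KontsevichZagierPeriods.KontsevichZagierPeriods.Theorems
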